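import Summits.ValiantsHypothesis.ValiantsHypothesis.Theorems.LacunarySymmetroidMatrixDescartesChainBlockM3K4F18
import Summits.ValiantsHypothesis.ValiantsHypothesis.Theorems.LacunarySymmetroidMatrixDescartesChainBlockM3K5T27

/-!
# `MatrixDescartes` census — MIXED CHAINS of the record blocks at `m = 3`: (3,8) ≥ 45, (3,11) ≥ 63, (3,12) ≥ 72, (3,15) ≥ 90, (3,16) ≥ 99, (3,19) ≥ 117, (3,20) ≥ 126

HONEST FRAMING.  Object-search cell `pub-symmetroid`, crux `Theses.LacunarySymmetroid.MatrixDescartes`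
(stmt-ValiantsHypothesis-18050); seat val-sym-mdr-p1 (g8).  LOWER-bound rows in census (CONJECTURE-A) currency; nothing about the crux
`MatrixDescartes` (upper bound at fat formats), `DoorA26` / `DoorA34`, or `VP ≠ VNP`.  No definitions.

The JUNCTION LAW FOR MATCHING JUNCTION INERTIA (`Chain.chain_append`, files `…ChainInertia.lean`, `…ChainBlocks.lean`) chains DIFFERENT census
certificates whenever the top letter of the chain and the bottom letter of the next block have the same inertia up to sign (Sylvester forms
`diagonal (±1, …)` recorded in the block files `…ChainBlock<X>.lean`; a block scaled by `−1` flips both of its forms).  At `m = 3` every record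
end letter is nonsingular and indefinite except the definite top of `F35`, at `m = 2` the definite family (`T14`, `G18`, the bottoms of `G25`, `T27`,
`T29`) and the indefinite family (`C22`, the tops of `G25`, `T27`, `T29`) chain within themselves.  Each row below adds the alternation counts
of its blocks (`K = 1 + Σ (K_block − 1)` letters); all exceed the self-chain / ladder rays of the same format.  [folklore]
-/

-- `Summit.ValiantsHypothesis.ValiantsHypothesis.…` repeats a component by the D-0017 layout
-- (single-conjunct summit), which the `dupNamespace` linter flags; the name is mandated.
set_option linter.dupNamespace false

namespace Summit.ValiantsHypothesis.ValiantsHypothesis.Theorems.LacunarySymmetroidMatrixDescartes.Census.Chain.MixM3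

open Summit.ValiantsHypothesis.ValiantsHypothesis.Theorems.MatrixDescartes.Negative (PosRootLawAt)
open scoped BigOperators Matrix

/-- **`ζ_sym(3,8) ≥ 45`** — the mixed chain `M3K4F18 ▹ M3K5T27` (junction law for matching junction inertia; `⁻` = block scaled by `−1`). [folklore] -/
theorem mix_3_8 : ¬ PosRootLawAt 3 8 44 := by
  have h := Summit.ValiantsHypothesis.ValiantsHypothesis.Theorems.LacunarySymmetroidMatrixDescartes.Census.Chain.not_posRootLawAt_of_certificateT (by norm_num)
    (Summit.ValiantsHypothesis.ValiantsHypothesis.Theorems.LacunarySymmetroidMatrixDescartes.Census.Chain.chain_append (by norm_num) (Summit.ValiantsHypothesis.ValiantsHypothesis.Theorems.LacunarySymmetroidMatrixDescartes.Census.Chain.chain_of_block Summit.ValiantsHypothesis.ValiantsHypothesis.Theorems.LacunarySymmetroidMatrixDescartes.Census.Chain.BlockM3K4F18.block)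
      Summit.ValiantsHypothesis.ValiantsHypothesis.Theorems.LacunarySymmetroidMatrixDescartes.Census.Chain.BlockM3K5T27.block
      (Equiv.refl (Fin 3)) (by intro i; fin_cases i <;> norm_num))
  norm_num at h
  exact h

/-- **`ζ_sym(3,11) ≥ 63`** — the mixed chain `M3K4F18 ▹ M3K4F18 ▹ M3K5T27` (junction law for matching junction inertia; `⁻` = block scaled by `−1`). [folklore] -/
theorem mix_3_11 : ¬ PosRootLawAt 3 11 62 := by
  have h := Summit.ValiantsHypothesis.ValiantsHypothesis.Theorems.LacunarySymmetroidMatrixDescartes.Census.Chain.not_posRootLawAt_of_certificateT (by norm_num)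
    (Summit.ValiantsHypothesis.ValiantsHypothesis.Theorems.LacunarySymmetroidMatrixDescartes.Census.Chain.chain_append (by norm_num) (Summit.ValiantsHypothesis.ValiantsHypothesis.Theorems.LacunarySymmetroidMatrixDescartes.Census.Chain.chain_append (by norm_num) (Summit.ValiantsHypothesis.ValiantsHypothesis.Theorems.LacunarySymmetroidMatrixDescartes.Census.Chain.chain_of_block Summit.ValiantsHypothesis.ValiantsHypothesis.Theorems.LacunarySymmetroidMatrixDescartes.Census.Chain.BlockM3K4F18.block)
      Summit.ValiantsHypothesis.ValiantsHypothesis.Theorems.LacunarySymmetroidMatrixDescartes.Census.Chain.BlockM3K4F18.block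
      (Equiv.refl (Fin 3)) (by intro i; fin_cases i <;> norm_num))
      Summit.ValiantsHypothesis.ValiantsHypothesis.Theorems.LacunarySymmetroidMatrixDescartes.Census.Chain.BlockM3K5T27.block
      (Equiv.refl (Fin 3)) (by intro i; fin_cases i <;> norm_num))
  norm_num at h
  exact h

/-- **`ζ_sym(3,12) ≥ 72`** — the mixed chain `M3K4F18 ▹ M3K5T27 ▹ M3K5T27⁻` (junction law for matching junction inertia; `⁻` = block scaled by `−1`). [folklore] -/
theorem mix_3_12 : ¬ PosRootLawAt 3 12 71 := by
  have h := Summit.ValiantsHypothesis.ValiantsHypothesis.Theorems.LacunarySymmetroidMatrixDescartes.Census.Chain.not_posRootLawAt_of_certificateT (by norm_num)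
    (Summit.ValiantsHypothesis.ValiantsHypothesis.Theorems.LacunarySymmetroidMatrixDescartes.Census.Chain.chain_append (by norm_num) (Summit.ValiantsHypothesis.ValiantsHypothesis.Theorems.LacunarySymmetroidMatrixDescartes.Census.Chain.chain_append (by norm_num) (Summit.ValiantsHypothesis.ValiantsHypothesis.Theorems.LacunarySymmetroidMatrixDescartes.Census.Chain.chain_of_block Summit.ValiantsHypothesis.ValiantsHypothesis.Theorems.LacunarySymmetroidMatrixDescartes.Census.Chain.BlockM3K4F18.block)
      Summit.ValiantsHypothesis.ValiantsHypothesis.Theorems.LacunarySymmetroidMatrixDescartes.Census.Chain.BlockM3K5T27.block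
      (Equiv.refl (Fin 3)) (by intro i; fin_cases i <;> norm_num))
      (Summit.ValiantsHypothesis.ValiantsHypothesis.Theorems.LacunarySymmetroidMatrixDescartes.Census.Chain.block_smul Summit.ValiantsHypothesis.ValiantsHypothesis.Theorems.LacunarySymmetroidMatrixDescartes.Census.Chain.BlockM3K5T27.block (-1) (by norm_num))
      (Equiv.refl (Fin 3)) (by intro i; fin_cases i <;> norm_num))
  norm_num at h
  exact h

/-- **`ζ_sym(3,15) ≥ 90`** — the mixed chain `M3K4F18 ▹ M3K4F18 ▹ M3K5T27 ▹ M3K5T27⁻` (junction law for matching junction inertia; `⁻` = block scaled by `−1`). [folklore] -/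
theorem mix_3_15 : ¬ PosRootLawAt 3 15 89 := by
  have h := Summit.ValiantsHypothesis.ValiantsHypothesis.Theorems.LacunarySymmetroidMatrixDescartes.Census.Chain.not_posRootLawAt_of_certificateT (by norm_num)
    (Summit.ValiantsHypothesis.ValiantsHypothesis.Theorems.LacunarySymmetroidMatrixDescartes.Census.Chain.chain_append (by norm_num) (Summit.ValiantsHypothesis.ValiantsHypothesis.Theorems.LacunarySymmetroidMatrixDescartes.Census.Chain.chain_append (by norm_num) (Summit.ValiantsHypothesis.ValiantsHypothesis.Theorems.LacunarySymmetroidMatrixDescartes.Census.Chain.chain_append (by norm_num) (Summit.ValiantsHypothesis.ValiantsHypothesis.Theorems.LacunarySymmetroidMatrixDescartes.Census.Chain.chain_of_block Summit.ValiantsHypothesis.ValiantsHypothesis.Theorems.LacunarySymmetroidMatrixDescartes.Census.Chain.BlockM3K4F18.block)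
      Summit.ValiantsHypothesis.ValiantsHypothesis.Theorems.LacunarySymmetroidMatrixDescartes.Census.Chain.BlockM3K4F18.block
      (Equiv.refl (Fin 3)) (by intro i; fin_cases i <;> norm_num))
      Summit.ValiantsHypothesis.ValiantsHypothesis.Theorems.LacunarySymmetroidMatrixDescartes.Census.Chain.BlockM3K5T27.block
      (Equiv.refl (Fin 3)) (by intro i; fin_cases i <;> norm_num))
      (Summit.ValiantsHypothesis.ValiantsHypothesis.Theorems.LacunarySymmetroidMatrixDescartes.Census.Chain.block_smul Summit.ValiantsHypothesis.ValiantsHypothesis.Theorems.LacunarySymmetroidMatrixDescartes.Census.Chain.BlockM3K5T27.block (-1) (by norm_num))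
      (Equiv.refl (Fin 3)) (by intro i; fin_cases i <;> norm_num))
  norm_num at h
  exact h

/-- **`ζ_sym(3,16) ≥ 99`** — the mixed chain `M3K4F18 ▹ M3K5T27 ▹ M3K5T27⁻ ▹ M3K5T27` (junction law for matching junction inertia; `⁻` = block scaled by `−1`). [folklore] -/
theorem mix_3_16 : ¬ PosRootLawAt 3 16 98 := by
  have h := Summit.ValiantsHypothesis.ValiantsHypothesis.Theorems.LacunarySymmetroidMatrixDescartes.Census.Chain.not_posRootLawAt_of_certificateT (by norm_num)
    (Summit.ValiantsHypothesis.ValiantsHypothesis.Theorems.LacunarySymmetroidMatrixDescartes.Census.Chain.chain_append (by norm_num) (Summit.ValiantsHypothesis.ValiantsHypothesis.Theorems.LacunarySymmetroidMatrixDescartes.Census.Chain.chain_append (by norm_num) (Summit.ValiantsHypothesis.ValiantsHypothesis.Theorems.LacunarySymmetroidMatrixDescartes.Census.Chain.chain_append (by norm_num) (Summit.ValiantsHypothesis.ValiantsHypothesis.Theorems.LacunarySymmetroidMatrixDescartes.Census.Chain.chain_of_block Summit.ValiantsHypothesis.ValiantsHypothesis.Theorems.LacunarySymmetroidMatrixD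escartes.Census.Chain.BlockM3K4F18.block)
      Summit.ValiantsHypothesis.ValiantsHypothesis.Theorems.LacunarySymmetroidMatrixDescartes.Census.Chain.BlockM3K5T27.block
      (Equiv.refl (Fin 3)) (by intro i; fin_cases i <;> norm_num))
      (Summit.ValiantsHypothesis.ValiantsHypothesis.Theorems.LacunarySymmetroidMatrixDescartes.Census.Chain.block_smul Summit.ValiantsHypothesis.ValiantsHypothesis.Theorems.LacunarySymmetroidMatrixDescartes.Census.Chain.BlockM3K5T27.block (-1) (by norm_num))
      (Equiv.refl (Fin 3)) (by intro i; fin_cases i <;> norm_num))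
      Summit.ValiantsHypothesis.ValiantsHypothesis.Theorems.LacunarySymmetroidMatrixDescartes.Census.Chain.BlockM3K5T27.block
      (Equiv.refl (Fin 3)) (by intro i; fin_cases i <;> norm_num))
  norm_num at h
  exact h

/-- **`ζ_sym(3,19) ≥ 117`** — the mixed chain `M3K4F18 ▹ M3K4F18 ▹ M3K5T27 ▹ M3K5T27⁻ ▹ M3K5T27` (junction law for matching junction inertia; `⁻` = block scaled by `−1`). [folklore] -/
theorem mix_3_19 : ¬ PosRootLawAt 3 19 116 := by
  have h := Summit.ValiantsHypothesis.ValiantsHypothesis.Theorems.LacunarySymmetroidMatrixDescartes.Census.Chain.not_posRootLawAt_of_certificateT (by norm_num)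
    (Summit.ValiantsHypothesis.ValiantsHypothesis.Theorems.LacunarySymmetroidMatrixDescartes.Census.Chain.chain_append (by norm_num) (Summit.ValiantsHypothesis.ValiantsHypothesis.Theorems.LacunarySymmetroidMatrixDescartes.Census.Chain.chain_append (by norm_num) (Summit.ValiantsHypothesis.ValiantsHypothesis.Theorems.LacunarySymmetroidMatrixDescartes.Census.Chain.chain_append (by norm_num) (Summit.ValiantsHypothesis.ValiantsHypothesis.Theorems.LacunarySymmetroidMatrixDescartes.Census.Chain.chain_append (by norm_num) (Summit.ValiantsHypothesis.ValiantsHypothesis.Theorems.LacunarySymmetroidMatrixDescartes.Census.Chain.chain_of_block Summit.ValiantsHypothesis.ValiantsHypothesis.Theorems.LacunarySymmetroidMatrixDescartes.Census.Chain.BlockM3K4F18.block)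
      Summit.ValiantsHypothesis.ValiantsHypothesis.Theorems.LacunarySymmetroidMatrixDescartes.Census.Chain.BlockM3K4F18.block
      (Equiv.refl (Fin 3)) (by intro i; fin_cases i <;> norm_num))
      Summit.ValiantsHypothesis.ValiantsHypothesis.Theorems.LacunarySymmetroidMatrixDescartes.Census.Chain.BlockM3K5T27.block
      (Equiv.refl (Fin 3)) (by intro i; fin_cases i <;> norm_num))
      (Summit.ValiantsHypothesis.ValiantsHypothesis.Theorems.LacunarySymmetroidMatrixDescartes.Census.Chain.block_smul Summit.ValiantsHypothesis.ValiantsHypothesis.Theorems.LacunarySymmetroidMatrixDescartes.Census.Chain.BlockM3K5T27.block (-1) (by norm_num))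
      (Equiv.refl (Fin 3)) (by intro i; fin_cases i <;> norm_num))
      Summit.ValiantsHypothesis.ValiantsHypothesis.Theorems.LacunarySymmetroidMatrixDescartes.Census.Chain.BlockM3K5T27.block
      (Equiv.refl (Fin 3)) (by intro i; fin_cases i <;> norm_num))
  norm_num at h
  exact h

/-- **`ζ_sym(3,20) ≥ 126`** — the mixed chain `M3K4F18 ▹ M3K5T27 ▹ M3K5T27⁻ ▹ M3K5T27 ▹ M3K5T27⁻` (junction law for matching junction inertia; `⁻` = block scaled by `−1`). [folklore] -/
theorem mix_3_20 : ¬ PosRootLawAt 3 20 125 := by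
  have h := Summit.ValiantsHypothesis.ValiantsHypothesis.Theorems.LacunarySymmetroidMatrixDescartes.Census.Chain.not_posRootLawAt_of_certificateT (by norm_num)
    (Summit.ValiantsHypothesis.ValiantsHypothesis.Theorems.LacunarySymmetroidMatrixDescartes.Census.Chain.chain_append (by norm_num) (Summit.ValiantsHypothesis.ValiantsHypothesis.Theorems.LacunarySymmetroidMatrixDescartes.Census.Chain.chain_append (by norm_num) (Summit.ValiantsHypothesis.ValiantsHypothesis.Theorems.LacunarySymmetroidMatrixDescartes.Census.Chain.chain_append (by norm_num) (Summit.ValiantsHypothesis.ValiantsHypothesis.Theorems.LacunarySymmetroidMatrixDescartes.Census.Chain.chain_append (by norm_num) (Summit.ValiantsHypothesis.ValiantsHypothesis.Theorems.LacunarySymmetroidMatrixDescartes.Census.Chain.chain_of_block Summit.ValiantsHypothesis.ValiantsHypothesis.Theorems.LacunarySymmetroidMatrixDescartes.Census.Chain.BlockM3K4F18.block)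
      Summit.ValiantsHypothesis.ValiantsHypothesis.Theorems.LacunarySymmetroidMatrixDescartes.Census.Chain.BlockM3K5T27.block
      (Equiv.refl (Fin 3)) (by intro i; fin_cases i <;> norm_num))
      (Summit.ValiantsHypothesis.ValiantsHypothesis.Theorems.LacunarySymmetroidMatrixDescartes.Census.Chain.block_smul Summit.ValiantsHypothesis.ValiantsHypothesis.Theorems.LacunarySymmetroidMatrixDescartes.Census.Chain.BlockM3K5T27.block (-1) (by norm_num))
      (Equiv.refl (Fin 3)) (by intro i; fin_cases i <;> norm_num))
      Summit.ValiantsHypothesis.ValiantsHypothesis.Theorems.LacunarySymmetroidMatrixDescartes.Census.Chain.BlockM3K5T27.block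
      (Equiv.refl (Fin 3)) (by intro i; fin_cases i <;> norm_num))
      (Summit.ValiantsHypothesis.ValiantsHypothesis.Theorems.LacunarySymmetroidMatrixDescartes.Census.Chain.block_smul Summit.ValiantsHypothesis.ValiantsHypothesis.Theorems.LacunarySymmetroidMatrixDescartes.Census.Chain.BlockM3K5T27.block (-1) (by norm_num))
      (Equiv.refl (Fin 3)) (by intro i; fin_cases i <;> norm_num))
  norm_num at h
  exact h

end Summit.ValiantsHypothesis.ValiantsHypothesis.Theorems.LacunarySymmetroidMatrixDescartes.Census.Chain.MixM3
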